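import Summits.BirchSwinnertonDyer.BirchSwinnertonDyer.Theorems.GenusKolyvaginAtTwoEquivariantKolyvaginExactAtTwoLocalDualityOrder
import Summits.BirchSwinnertonDyer.BirchSwinnertonDyer.Theorems.ByReductionTypeAtTwoRankOneAtTwoOffBigImageOddLocalEngineRegularReductionCyclic
import HarnessLib

/-!
# Route `ByReductionTypeAtTwo`, crux `RankOneAtTwoOffBigImageOddLocal` (stmt-BirchSwinnertonDyer-23716), line
# `refined_kolyvagin_tamagawa_shift_at_two`, stub `stub_sigmaShiftPosDisc`: the LOCAL STRUCTURE over `ℚ_ℓ` at a **REGULAR** Kolyvagin prime —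
# `E(ℚ_ℓ)[2^M]` cyclic of order `2^M`, `#H¹(ℚ_ℓ, E[2^M]) = 4^M`, `#H¹(ℚ_ℓ, E)[2^M] = 2^M`, `[E(ℚ_ℓ) : 2^M] = 2^M`, `#𝓛_ℓ = 2^M` — no sign condition on `Δ`

Lead prover `prover-cruxlead-stmt-BirchSwinnertonDyer-23716-g4` (2026-08-28; `--supports` the crux, closes nothing).  Fifth regular-engine CONSUMER:
the sibling route's `GenusExact.ReductionCyclic` (file `…LocalTorsionCount`) and `GenusExact.LocalDualityOrder` theorems that carry (`Δ < 0`,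
`FrobEqFrobInfty`) — all of them through the single count `#Ẽ_ℓ(𝔽_ℓ)[2^M] = 2^M` / `#Ẽ_ℓ(𝔽_ℓ)[2] = 2` — re-proved over the regular count of
`…EngineRegularReductionCyclic` (p665151): McCallum's Lemma 5.3 (i) «duality of cyclic groups of order `p^M`» over `ℚ_ℓ` at `p = 2` for a prime whose
Frobenius is an involution of `E[2]` MOVING a point (the engine's primes; on `Δ < 0` also the Gross–Kolyvagin primes).  Statements are the sibling's
verbatim with the regular datum in place of (`hΔ`, `hℓ`); proofs verbatim over the new count.  The regular datum is taken at level `2`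
(`geomTorsion W ((2 : ℕ) : ℤ)`), which is all the count uses.

THEOREMS ONLY (no definition, no named fact, no `sorry`, standard axioms).  BSD is not proved by any of this; the crux is not proved; the stub is not proved.

References: [McCallumLMS1991] §5 Lemma 5.3; [GrossLMS1991] §3 (3.2)–(3.3); [MilneADT2006] I Thm. 2.8, Lemma 3.3, Cor. 3.4; [SilvermanAEC2009]
Prop. VII.3.1(b), VII.4.1(a).
-/

set_option autoImplicit false
set_option linter.dupNamespace false -- tree convention: `Summit.BirchSwinnertonDyer.BirchSwinnertonDyer.Theorems` (summit = sub-problem)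

noncomputable section

open scoped Classical

namespace Summit.BirchSwinnertonDyer.BirchSwinnertonDyer.Theorems.OffBigImageOddLocalAtTwo.Engine

open CategoryTheory Function
open _root_.WeierstrassCurve Field NumberField IsDedekindDomain
open Literature.NumberTheory.EllipticCurves Literature.NumberTheory.GaloisRepresentations
open Literature.NumberTheory.EllipticCurves.Rank1Residual
open Summit.BirchSwinnertonDyer.BirchSwinnertonDyer.Theorems.GenusExact.ReductionCyclic
open Summit.BirchSwinnertonDyer.BirchSwinnertonDyer.Theorems.GenusExact.LocalDualityOrder
open scoped ContRepresentation

variable (W : WeierstrassCurve ℚ) [W.IsElliptic] [W.IsGloballyMinimal]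

/-! ## §1 `E(ℚ_ℓ)[2^M]` at a regular Kolyvagin prime -/

/-- **`#E(ℚ_ℓ)[2^M] = 2^M` at a REGULAR Kolyvagin prime of Kolyvagin index `≥ M` (any sign of `Δ`)** — the sibling's
`natCard_ker_zsmul_adicCompletion_two_pow_eq` over the regular reduction count `natCard_torsionBy_reductionAt_two_pow_eq_regular`.
[cite: McCallumLMS1991, §5 Lemma 5.3] [cite: GrossLMS1991, §3 (3.2)–(3.3)] -/
theorem natCard_ker_zsmul_adicCompletion_two_pow_eq_regular {ℓ : ℕ} [Fact ℓ.Prime] (hℓ2 : ℓ ≠ 2)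
    (hgoodℓ : W.HasGoodReductionAtPrime ℓ) {v : HeightOneSpectrum (𝓞 ℚ)} (hv : (ℓ : 𝓞 ℚ) ∈ v.asIdeal)
    (hreg : ∃ (𝔓 : Ideal (absIntegers (𝓞 ℚ) ℚ)) (h : absoluteGaloisGroup ℚ), 𝔓 ∈ v.primesAbove ∧
      IsArithFrobAt (𝓞 ℚ) h 𝔓 ∧ (∀ P : geomTorsion W ((2 : ℕ) : ℤ), h • h • P = P) ∧
      ∃ u : geomTorsion W ((2 : ℕ) : ℤ), h • u ≠ u) {M : ℕ}
    (hM : M ≤ Zhang2014.kolyvaginIndex W 2 ℓ) :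
    Nat.card (zsmulAddGroupHom ((2 ^ M : ℕ) : ℤ) :
        (W.baseChange (v.adicCompletion ℚ)).toAffine.Point →+ _).ker = 2 ^ M := by
  haveI : Fact (Nat.Prime 2) := ⟨Nat.prime_two⟩
  have hℓp : ℓ.Prime := Fact.out
  have hvℓ : (Rat.HeightOneSpectrum.primesEquiv v : ℕ) = ℓ := primesEquiv_eq_of_natCast_mem hℓp hv
  have hgood : W.HasGoodReductionAt v :=
    (hasGoodReductionAtPrime_primesEquiv_iff_holds W v ℓ hvℓ).mp hgoodℓ
  have hnv : ((((2 ^ M : ℕ) : ℤ)) : 𝓞 ℚ) ∉ v.asIdeal := by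
    intro hmem
    haveI := v.isPrime
    have h2 : ((2 : ℕ) : 𝓞 ℚ) ∈ v.asIdeal := by
      have hpow : ((2 : 𝓞 ℚ)) ^ M ∈ v.asIdeal := by exact_mod_cast hmem
      exact_mod_cast v.isPrime.mem_of_pow_mem M hpow
    exact hℓ2 (hvℓ.symm.trans (primesEquiv_eq_of_natCast_mem Nat.prime_two h2))
  obtain ⟨σ₀, 𝔓₀', h𝔓₀', hσ₀, hcount⟩ :=
    Summit.BirchSwinnertonDyer.Rank1Residual.GaloisImage.FrobShape.exists_frobenius_natCard_fixed_eq
      W 2 ℓ hℓ2 hgoodℓ hv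
  have h𝔓₀ := adicCompletionPrime_mem_primesAbove ℚ v
  obtain ⟨g, hg⟩ := HeightOneSpectrum.exists_smul_eq_of_mem_primesAbove_holds h𝔓₀' h𝔓₀
  have hΦ : IsArithFrobAt (𝓞 ℚ) (g * σ₀ * g⁻¹) (adicCompletionPrime ℚ v) := hg ▸ hσ₀.conj g
  rw [natCard_ker_zsmul_adicCompletion_eq W (by positivity) hgood hnv hΦ]
  have hcongr : Nat.card {P : geomTorsion W ((2 ^ M : ℕ) : ℤ) // (g * σ₀ * g⁻¹) • P = P} =
      Nat.card {P : geomTorsion W ((2 ^ M : ℕ) : ℤ) // σ₀ • P = P} := by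
    refine Nat.card_congr
      { toFun := fun P ↦ ⟨g⁻¹ • P.1, by
          have h := P.2
          rw [mul_smul, mul_smul] at h
          have h' := congrArg (fun Q ↦ g⁻¹ • Q) h
          simpa only [inv_smul_smul] using h'⟩
        invFun := fun Q ↦ ⟨g • Q.1, by rw [mul_smul, mul_smul, inv_smul_smul, Q.2]⟩
        left_inv := fun P ↦ Subtype.ext (smul_inv_smul g P.1)
        right_inv := fun Q ↦ Subtype.ext (inv_smul_smul g Q.1) }
  rw [hcongr, hcount M]
  exact natCard_torsionBy_reductionAt_two_pow_eq_regular W hℓ2 hgoodℓ hv hreg hM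

/-- **`#E(ℚ_ℓ)[2] = 2` at a REGULAR Kolyvagin prime** (no index hypothesis; any sign of `Δ`). [cite: SilvermanAEC2009, Prop. VII.3.1(b)] -/
theorem natCard_ker_zsmul_adicCompletion_two_eq_regular {ℓ : ℕ} [Fact ℓ.Prime] (hℓ2 : ℓ ≠ 2)
    (hgoodℓ : W.HasGoodReductionAtPrime ℓ) {v : HeightOneSpectrum (𝓞 ℚ)} (hv : (ℓ : 𝓞 ℚ) ∈ v.asIdeal)
    (hreg : ∃ (𝔓 : Ideal (absIntegers (𝓞 ℚ) ℚ)) (h : absoluteGaloisGroup ℚ), 𝔓 ∈ v.primesAbove ∧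
      IsArithFrobAt (𝓞 ℚ) h 𝔓 ∧ (∀ P : geomTorsion W ((2 : ℕ) : ℤ), h • h • P = P) ∧
      ∃ u : geomTorsion W ((2 : ℕ) : ℤ), h • u ≠ u) :
    Nat.card (zsmulAddGroupHom ((2 : ℕ) : ℤ) :
        (W.baseChange (v.adicCompletion ℚ)).toAffine.Point →+ _).ker = 2 := by
  haveI : Fact (Nat.Prime 2) := ⟨Nat.prime_two⟩
  have hℓp : ℓ.Prime := Fact.out
  have hvℓ : (Rat.HeightOneSpectrum.primesEquiv v : ℕ) = ℓ := primesEquiv_eq_of_natCast_mem hℓp hv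
  have hgood : W.HasGoodReductionAt v :=
    (hasGoodReductionAtPrime_primesEquiv_iff_holds W v ℓ hvℓ).mp hgoodℓ
  have hnv : ((((2 : ℕ) : ℤ)) : 𝓞 ℚ) ∉ v.asIdeal := by
    intro hmem
    have h2 : ((2 : ℕ) : 𝓞 ℚ) ∈ v.asIdeal := by exact_mod_cast hmem
    exact hℓ2 (hvℓ.symm.trans (primesEquiv_eq_of_natCast_mem Nat.prime_two h2))
  obtain ⟨σ₀, 𝔓₀', h𝔓₀', hσ₀, hcount⟩ :=
    Summit.BirchSwinnertonDyer.Rank1Residual.GaloisImage.FrobShape.exists_frobenius_natCard_fixed_eq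
      W 2 ℓ hℓ2 hgoodℓ hv
  have h𝔓₀ := adicCompletionPrime_mem_primesAbove ℚ v
  obtain ⟨g, hg⟩ := HeightOneSpectrum.exists_smul_eq_of_mem_primesAbove_holds h𝔓₀' h𝔓₀
  have hΦ : IsArithFrobAt (𝓞 ℚ) (g * σ₀ * g⁻¹) (adicCompletionPrime ℚ v) := hg ▸ hσ₀.conj g
  rw [natCard_ker_zsmul_adicCompletion_eq W (by norm_num) hgood hnv hΦ]
  have hcongr : Nat.card {P : geomTorsion W ((2 : ℕ) : ℤ) // (g * σ₀ * g⁻¹) • P = P} =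
      Nat.card {P : geomTorsion W ((2 : ℕ) : ℤ) // σ₀ • P = P} := by
    refine Nat.card_congr
      { toFun := fun P ↦ ⟨g⁻¹ • P.1, by
          have h := P.2
          rw [mul_smul, mul_smul] at h
          have h' := congrArg (fun Q ↦ g⁻¹ • Q) h
          simpa only [inv_smul_smul] using h'⟩
        invFun := fun Q ↦ ⟨g • Q.1, by rw [mul_smul, mul_smul, inv_smul_smul, Q.2]⟩
        left_inv := fun P ↦ Subtype.ext (smul_inv_smul g P.1)
        right_inv := fun Q ↦ Subtype.ext (inv_smul_smul g Q.1) }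
  have h1 := hcount 1
  rw [pow_one] at h1
  rw [hcongr, h1]
  exact natCard_twoTorsion_reductionAt_eq_two_of_regularFrob W hℓ2 hgoodℓ hv hreg

/-- **`E(ℚ_ℓ)[2^M]` is CYCLIC OF ORDER `2^M` at a REGULAR Kolyvagin prime of index `≥ M`** (any sign of `Δ`) — McCallum's Lemma 5.3 (i) over `ℚ_ℓ` at
`2` in full. [cite: McCallumLMS1991, §5 Lemma 5.3] -/
theorem isAddCyclic_ker_zsmul_adicCompletion_two_pow_regular {ℓ : ℕ} [Fact ℓ.Prime] (hℓ2 : ℓ ≠ 2)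
    (hgoodℓ : W.HasGoodReductionAtPrime ℓ) {v : HeightOneSpectrum (𝓞 ℚ)} (hv : (ℓ : 𝓞 ℚ) ∈ v.asIdeal)
    (hreg : ∃ (𝔓 : Ideal (absIntegers (𝓞 ℚ) ℚ)) (h : absoluteGaloisGroup ℚ), 𝔓 ∈ v.primesAbove ∧
      IsArithFrobAt (𝓞 ℚ) h 𝔓 ∧ (∀ P : geomTorsion W ((2 : ℕ) : ℤ), h • h • P = P) ∧
      ∃ u : geomTorsion W ((2 : ℕ) : ℤ), h • u ≠ u) {M : ℕ}
    (hM : M ≤ Zhang2014.kolyvaginIndex W 2 ℓ) :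
    IsAddCyclic (zsmulAddGroupHom ((2 ^ M : ℕ) : ℤ) :
        (W.baseChange (v.adicCompletion ℚ)).toAffine.Point →+ _).ker ∧
      Nonempty ((zsmulAddGroupHom ((2 ^ M : ℕ) : ℤ) :
        (W.baseChange (v.adicCompletion ℚ)).toAffine.Point →+ _).ker ≃+ ZMod (2 ^ M)) := by
  set G := (zsmulAddGroupHom ((2 ^ M : ℕ) : ℤ) :
    (W.baseChange (v.adicCompletion ℚ)).toAffine.Point →+ _).ker with hG
  have hcard : Nat.card G = 2 ^ M :=
    natCard_ker_zsmul_adicCompletion_two_pow_eq_regular W hℓ2 hgoodℓ hv hreg hM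
  haveI : Finite G := Nat.finite_of_card_ne_zero (by rw [hcard]; positivity)
  have h2 := natCard_ker_zsmul_adicCompletion_two_eq_regular W hℓ2 hgoodℓ hv hreg
  have hkill : ∀ x : G, 2 ^ M • x = 0 := fun x ↦ by
    apply Subtype.ext
    have hx : (((2 ^ M : ℕ) : ℤ)) • (x : (W.baseChange (v.adicCompletion ℚ)).toAffine.Point) = 0 := x.2
    rw [natCast_zsmul] at hx
    rw [AddSubmonoidClass.coe_nsmul, ZeroMemClass.coe_zero]
    exact hx
  haveI : Finite (zsmulAddGroupHom ((2 : ℕ) : ℤ) :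
      (W.baseChange (v.adicCompletion ℚ)).toAffine.Point →+ _).ker :=
    Nat.finite_of_card_ne_zero (by rw [h2]; norm_num)
  have hle : Nat.card {x : G // 2 • x = 0} ≤ 2 := by
    have hinj : Nat.card {x : G // 2 • x = 0} ≤ Nat.card (zsmulAddGroupHom ((2 : ℕ) : ℤ) :
        (W.baseChange (v.adicCompletion ℚ)).toAffine.Point →+ _).ker := by
      refine Nat.card_le_card_of_injective
        (fun x ↦ ⟨((x.1 : G) : (W.baseChange (v.adicCompletion ℚ)).toAffine.Point), by
          change (((2 : ℕ) : ℤ)) • ((x.1 : G) : (W.baseChange (v.adicCompletion ℚ)).toAffine.Point) = 0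
          rw [natCast_zsmul]
          have h := congrArg Subtype.val x.2
          simpa only [AddSubmonoidClass.coe_nsmul, ZeroMemClass.coe_zero] using h⟩) ?_
      intro x y h
      have h' := congrArg Subtype.val h
      exact Subtype.ext (Subtype.ext h')
    exact hinj.trans h2.le
  have hcyc : IsAddCyclic G :=
    KolyvaginEigenPow.isAddCyclic_of_card_torsion_le (p := 2) (M := M) Nat.prime_two hkill hle
  exact ⟨hcyc, ⟨(hcard ▸ (zmodAddCyclicAddEquiv hcyc).symm :)⟩⟩

/-! ## §2 Cohomological orders over `ℚ_ℓ` at a regular Kolyvagin prime -/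

/-- **`#H¹(ℚ_ℓ, E[2^M]) = 4^M`** at a REGULAR Kolyvagin prime of index `≥ M` (any sign of `Δ`; Euler characteristic off `2`).
[cite: McCallumLMS1991, §5 Lemma 5.3] [cite: MilneADT2006, Ch. I, Thm. 2.8] -/
theorem natCard_galoisCohomology_one_two_pow_eq_regular {ℓ : ℕ} [Fact ℓ.Prime] (hℓ2 : ℓ ≠ 2)
    (hgoodℓ : W.HasGoodReductionAtPrime ℓ) {v : HeightOneSpectrum (𝓞 ℚ)} (hv : (ℓ : 𝓞 ℚ) ∈ v.asIdeal)
    (hreg : ∃ (𝔓 : Ideal (absIntegers (𝓞 ℚ) ℚ)) (h : absoluteGaloisGroup ℚ), 𝔓 ∈ v.primesAbove ∧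
      IsArithFrobAt (𝓞 ℚ) h 𝔓 ∧ (∀ P : geomTorsion W ((2 : ℕ) : ℤ), h • h • P = P) ∧
      ∃ u : geomTorsion W ((2 : ℕ) : ℤ), h • u ≠ u) {M : ℕ} (hM0 : M ≠ 0)
    (hM : M ≤ Zhang2014.kolyvaginIndex W 2 ℓ) :
    Nat.card (galoisCohomology
        (GaloisRep.restrictField (v.adicCompletion ℚ) (W.torsionGaloisModule ((2 ^ M : ℕ) : ℤ))) 1) =
      4 ^ M := by
  haveI : Fact (Nat.Prime 2) := ⟨Nat.prime_two⟩
  rw [natCard_galoisCohomology_one_torsion_eq_sq_of_not_mem v W hM0 (two_notMem_of_odd_prime_mem hℓ2 hv),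
    ← zsmulAddGroupHom_natCast, natCard_ker_zsmul_adicCompletion_two_pow_eq_regular W hℓ2 hgoodℓ hv hreg hM,
    ← pow_mul, mul_comm, pow_mul]
  norm_num

/-- **`#H¹(ℚ_ℓ, E)[2^M] = 2^M`** at a REGULAR Kolyvagin prime of index `≥ M` (any sign of `Δ`; Tate local duality off `2`).
[cite: McCallumLMS1991, §5 Lemma 5.3] [cite: MilneADT2006, Ch. I, Thm. 3.2] -/
theorem natCard_torsionBy_localH1_two_pow_eq_regular {ℓ : ℕ} [Fact ℓ.Prime] (hℓ2 : ℓ ≠ 2)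
    (hgoodℓ : W.HasGoodReductionAtPrime ℓ) {v : HeightOneSpectrum (𝓞 ℚ)} (hv : (ℓ : 𝓞 ℚ) ∈ v.asIdeal)
    (hreg : ∃ (𝔓 : Ideal (absIntegers (𝓞 ℚ) ℚ)) (h : absoluteGaloisGroup ℚ), 𝔓 ∈ v.primesAbove ∧
      IsArithFrobAt (𝓞 ℚ) h 𝔓 ∧ (∀ P : geomTorsion W ((2 : ℕ) : ℤ), h • h • P = P) ∧
      ∃ u : geomTorsion W ((2 : ℕ) : ℤ), h • u ≠ u) {M : ℕ} (hM0 : M ≠ 0)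
    (hM : M ≤ Zhang2014.kolyvaginIndex W 2 ℓ) :
    Nat.card (AddSubgroup.torsionBy
        (galoisCohomology (W.localGaloisModule (v.adicCompletion ℚ)) 1) ((2 ^ M : ℕ) : ℤ)) =
      2 ^ M := by
  haveI : Fact (Nat.Prime 2) := ⟨Nat.prime_two⟩
  rw [natCard_torsionBy_localH1_eq_of_not_mem v W hM0 (two_notMem_of_odd_prime_mem hℓ2 hv),
    ← zsmulAddGroupHom_natCast]
  exact natCard_ker_zsmul_adicCompletion_two_pow_eq_regular W hℓ2 hgoodℓ hv hreg hM

/-- **`[E(ℚ_ℓ) : 2^M E(ℚ_ℓ)] = 2^M`** at a REGULAR Kolyvagin prime of index `≥ M` (any sign of `Δ`; Milne I Lemma 3.3 off `2`).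
[cite: McCallumLMS1991, §5 Lemma 5.3] [cite: MilneADT2006, I Lemma 3.3] -/
theorem index_range_two_pow_eq_regular {ℓ : ℕ} [Fact ℓ.Prime] (hℓ2 : ℓ ≠ 2)
    (hgoodℓ : W.HasGoodReductionAtPrime ℓ) {v : HeightOneSpectrum (𝓞 ℚ)} (hv : (ℓ : 𝓞 ℚ) ∈ v.asIdeal)
    (hreg : ∃ (𝔓 : Ideal (absIntegers (𝓞 ℚ) ℚ)) (h : absoluteGaloisGroup ℚ), 𝔓 ∈ v.primesAbove ∧
      IsArithFrobAt (𝓞 ℚ) h 𝔓 ∧ (∀ P : geomTorsion W ((2 : ℕ) : ℤ), h • h • P = P) ∧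
      ∃ u : geomTorsion W ((2 : ℕ) : ℤ), h • u ≠ u) {M : ℕ}
    (hM : M ≤ Zhang2014.kolyvaginIndex W 2 ℓ) :
    (nsmulAddMonoidHom (2 ^ M) : (W.baseChange (v.adicCompletion ℚ)).toAffine.Point →+ _).range.index =
      2 ^ M := by
  haveI : Fact (Nat.Prime 2) := ⟨Nat.prime_two⟩
  rw [index_range_nsmul_eq_of_not_mem v W M (two_notMem_of_odd_prime_mem hℓ2 hv),
    ← zsmulAddGroupHom_natCast]
  exact natCard_ker_zsmul_adicCompletion_two_pow_eq_regular W hℓ2 hgoodℓ hv hreg hM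

/-- **`#𝓛_ℓ = 2^M`** — the order of the local Kummer condition at a REGULAR Kolyvagin prime of index `≥ M` (any sign of `Δ`).
[cite: McCallumLMS1991, §5 Lemma 5.3] [cite: MilneADT2006, I Lemma 3.3 and Cor. 3.4] -/
theorem natCard_kummerLocalConditionAt_two_pow_eq_regular {ℓ : ℕ} [Fact ℓ.Prime] (hℓ2 : ℓ ≠ 2)
    (hgoodℓ : W.HasGoodReductionAtPrime ℓ) {v : HeightOneSpectrum (𝓞 ℚ)} (hv : (ℓ : 𝓞 ℚ) ∈ v.asIdeal)
    (hreg : ∃ (𝔓 : Ideal (absIntegers (𝓞 ℚ) ℚ)) (h : absoluteGaloisGroup ℚ), 𝔓 ∈ v.primesAbove ∧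
      IsArithFrobAt (𝓞 ℚ) h 𝔓 ∧ (∀ P : geomTorsion W ((2 : ℕ) : ℤ), h • h • P = P) ∧
      ∃ u : geomTorsion W ((2 : ℕ) : ℤ), h • u ≠ u) {M : ℕ}
    (hM : M ≤ Zhang2014.kolyvaginIndex W 2 ℓ) :
    Nat.card (W.kummerLocalConditionAt ((2 ^ M : ℕ) : ℤ) (v.adicCompletion ℚ)) = 2 ^ M := by
  haveI : Fact (Nat.Prime 2) := ⟨Nat.prime_two⟩
  rw [W.natCard_kummerLocalConditionAt_adicCompletion v (pow_ne_zero M two_ne_zero),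
    natCard_quotient_span_natCast_eq_one v
      (natCast_pow_notMem v (two_notMem_of_odd_prime_mem hℓ2 hv) M), mul_one,
    ← zsmulAddGroupHom_natCast]
  exact natCard_ker_zsmul_adicCompletion_two_pow_eq_regular W hℓ2 hgoodℓ hv hreg hM

end Summit.BirchSwinnertonDyer.BirchSwinnertonDyer.Theorems.OffBigImageOddLocalAtTwo.Engine

end
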